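import Mathlib
import Literature.NumberTheory.Irrationality.Zudilin2002.WellPoisedIntegrals
import HarnessLib.Audit
import HarnessLib

/-!
HONEST FRAMING: systematic search; no irrationality claim unless certified.

Filed for fam-sorokin gen 2 (planner-pub-zeta5-fam-sorokin-g2-0, 2026-08-20; staged `gen2/lean/SorokinCone.lean.txt`, sha256 b4676594…)
by the cell's filing lane (lead/lit g11; hygiene only: `import HarnessLib`, `@[conjecture]` tags, this paragraph). TYPED STATEMENTS of
families/sorokin/FAMILY.md §15b (cone expansion — an elementary THEOREM on paper) and §15d (Conjecture D —
census-backed, 268,932 exact evaluations, no proof).  Statements only (`def … : Prop`), no `sorry`, no axioms.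
Home: `Summits/KontsevichZagierPeriods/Zeta5Search/SorokinCensus/Cone.lean`. The four statements are tagged `@[conjecture]`
(cell convention for named targets: `ExpansionMove`/`ConeExpansion` are THEOREMS ON PAPER not yet formalised; `SorokinSingleZeta` is
CONJECTURE D; `NoOddRayOffCone` is a documentary conjecture).
Indices as in the tree: `a j`, `b j` for `j = 0,…,4` are a_{j+1}, b_{j+1}; c_{j+1} = b j − a j; `sorokinIntegral 5 a₀ a b`
is the Bochner integral over the closed cube (junk 0 if not integrable).
-/

namespace Summit.KontsevichZagierPeriods.Zeta5Search.SorokinCensus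

open Literature.NumberTheory.Irrationality.Zudilin2002 MeasureTheory Finset

/-- The unit cube `[0,1]^k`. -/
def cube (k : ℕ) : Set (Fin k → ℝ) := Set.pi Set.univ fun _ : Fin k => Set.Icc (0 : ℝ) 1

/-- Integrability of the Sorokin integrand at integer parameters (the box `ℬ` of FAMILY.md §1). -/
def J5Integrable (a₀ : ℕ) (a b : ℕ → ℕ) : Prop :=
  IntegrableOn (sorokinIntegrand 5 (a₀ : ℝ) (fun j => (a j : ℝ)) (fun j => (b j : ℝ))) (cube 5)

/-- `J₅` at integer parameters. -/
noncomputable def J5 (a₀ : ℕ) (a b : ℕ → ℕ) : ℝ :=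
  sorokinIntegral 5 (a₀ : ℝ) (fun j => (a j : ℝ)) (fun j => (b j : ℝ))

/-- ONE EXPANSION MOVE `P_j(N)` (FAMILY §15b; binomial theorem `(x_j + (1 - x_j))^N = 1` inserted into the
integrand, then linearity of the integral on integrable non-negative terms):
`J₅(a₀; a | b) = Σ_{i=0}^{N} C(N,i) · J₅(a₀; a + i·δ_j | b + N·δ_j)` — `a_j` rises by `i`, `c_j` by `N − i`,
hence `b_j` by `N`.  Holds for every `j < 5` and `N`, at every integrable integer point with `1 ≤ a_j < b_j`.
THEOREM on paper (elementary); composing `P₃, P₂, P₁` with the right `N`'s maps every point of the negative-defect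
cone `N₅ = {b₁+a₂ ≤ b₂+a₃ ≤ b₃+a₄ ≤ b₄+a₅}` onto the very-well-poised locus with positive integer coefficients. -/
@[conjecture] def ExpansionMove : Prop :=
  ∀ (a₀ : ℕ) (a b : ℕ → ℕ) (j N : ℕ), j < 5 → 1 ≤ a₀ → (∀ i < 5, 1 ≤ a i ∧ a i < b i) →
    J5Integrable a₀ a b →
      J5 a₀ a b =
        ∑ i ∈ range (N + 1),
          (N.choose i : ℝ) * J5 a₀ (Function.update a j (a j + i)) (Function.update b j (b j + N))

/-- The very-well-poised locus `L₅` (Zudilin 2003 (75)): `b₁+a₂ = b₂+a₃ = b₃+a₄ = b₄+a₅`. -/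
def OnL (a b : ℕ → ℕ) : Prop :=
  b 0 + a 1 = b 1 + a 2 ∧ b 1 + a 2 = b 2 + a 3 ∧ b 2 + a 3 = b 3 + a 4

/-- The negative-defect cone `N₅`: `b₁+a₂ ≤ b₂+a₃ ≤ b₃+a₄ ≤ b₄+a₅`. -/
def InCone (a b : ℕ → ℕ) : Prop :=
  b 0 + a 1 ≤ b 1 + a 2 ∧ b 1 + a 2 ≤ b 2 + a 3 ∧ b 2 + a 3 ≤ b 3 + a 4

/-- CONE EXPANSION THEOREM (FAMILY §15b, THEOREM on paper; corollary of three `ExpansionMove`s): every cone value is a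
non-negative-integer combination of finitely many very-well-poised values with the same `a₀` and the same
`S = b₄ + a₅`.  (Stated with an abstract finite family; the explicit triple-binomial multiplicities are in §15b.) -/
@[conjecture] def ConeExpansion : Prop :=
  ∀ (a₀ : ℕ) (a b : ℕ → ℕ), 1 ≤ a₀ → (∀ i < 5, 1 ≤ a i ∧ a i < b i) → J5Integrable a₀ a b → InCone a b →
    ∃ (n : ℕ) (m : Fin n → ℕ) (a' b' : Fin n → ℕ → ℕ),
      (∀ t, OnL (a' t) (b' t) ∧ (∀ i < 5, 1 ≤ a' t i ∧ a' t i < b' t i) ∧ J5Integrable a₀ (a' t) (b' t) ∧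
            b' t 3 + a' t 4 = b 3 + a 4) ∧
      J5 a₀ a b = ∑ t, (m t : ℝ) * J5 a₀ (a' t) (b' t)

/-- CONJECTURE D (FAMILY §15d; census-backed: coefficient of ζ(2)ζ(3) is 0 in 268,932 exact evaluations, none
failing): every convergent integer `J₅` is a ℚ-combination of `1, ζ(2), ζ(3), ζ(4), ζ(5)` — no `ζ(2)ζ(3)`.
(A priori, by Zlobin 2002 / Brown, it is a ℚ-combination of the six MZVs of weight ≤ 5 incl. `ζ(2)ζ(3)`.) -/
@[conjecture] def SorokinSingleZeta : Prop :=
  ∀ (a₀ : ℕ) (a b : ℕ → ℕ), 1 ≤ a₀ → (∀ i < 5, 1 ≤ a i ∧ a i < b i) → J5Integrable a₀ a b →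
    ∃ q : Fin 6 → ℚ, q 5 = 0 ∧
      J5 a₀ a b = q 0 + q 1 * (riemannZeta 2).re + q 2 * (riemannZeta 3).re + q 3 * (riemannZeta 4).re
                    + q 4 * (riemannZeta 5).re + q 5 * ((riemannZeta 2).re * (riemannZeta 3).re)

/-- CONJECTURE (FAMILY §15c(v), census: the whole box a₀ ≤ 3, exponents ≤ 3): OFF the cone and its σ-image, no RAY
`n ↦ n • p` of the raw family stays inside `ℚ + ℚζ(3) + ℚζ(5)`; typed here in the weak pointwise-at-`n = 2` form that the
census actually verified for the 165 odd discovery points (documentary; not proposed as a tree target). -/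
@[conjecture] def NoOddRayOffCone : Prop :=
  ∀ (a₀ : ℕ) (a b : ℕ → ℕ), 1 ≤ a₀ → (∀ i < 5, 1 ≤ a i ∧ a i < b i) → J5Integrable a₀ a b →
    ¬ InCone a b → ¬ InCone (Function.update (Function.update a 3 (b 4 - a 4)) 4 (b 3 - a 3))
                            (Function.update (Function.update b 3 (b 4)) 4 (b 3)) →
    (∀ n ≥ 1, ∃ q : Fin 3 → ℚ, J5 (n * a₀) (fun j => n * a j) (fun j => n * b j)
        = q 0 + q 1 * (riemannZeta 3).re + q 2 * (riemannZeta 5).re) → False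

end Summit.KontsevichZagierPeriods.Zeta5Search.SorokinCensus
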